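import Literature.NumberTheory.ComplexMultiplication.EllipticUnits.ImaginaryQuadraticMainConjectureCarriers
import Literature.NumberTheory.Automorphic.JacquetLanglandsParts
import HarnessLib

/-!
# Admissible twists exist: `∃ 𝔞, IsTwist p 𝔣 𝔞` and `Nonempty (AuxIdeals p 𝔣)` for `𝔣 ≠ 0`

Cell `bsd-print-cf2`, width seat `bsd-line-cf2-p1-w2` g19; crux child `MainConjClauseAtSplitTwoQuadDA`
(stmt-BirchSwinnertonDyer-24721), `--supports` helper; Theses-free; THEOREMS ONLY; 0 facts / 0 sorry.

The class-frame assemblies of ROW 2 / (β5) display a binder `b : AuxIdeals p 𝔣` (an admissible twist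
`𝔞 ≠ 𝒪_K` prime to `6p𝔣`, Kato §15.6; e.g. `TwistedZeta.hZC_of_inputs`, `hLat₀_of_twistedIwasawaData`) which the
supplier must instantiate. This file provides the witness: a number field has infinitely many finite places,
only finitely many divide `6p𝔣 ≠ 0`, and a prime `𝔩 ∤ 6p𝔣` is an admissible twist; indeed the admissible PRIME
twists form an infinite (cofinite) set of places.

* (`Literature.NumberTheory.Automorphic.infinite_heightOneSpectrum`, landed — `𝓞 K` has infinitely many non-zero primes;)
* `isCoprime_asIdeal_of_not_dvd` — a prime not dividing `𝔪` is coprime to `𝔪`;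
* `katoModulus6_ne_bot` — `6p𝔣 ≠ 0` for `𝔣 ≠ 0`;
* `isTwist_asIdeal_of_not_dvd` — `𝔩 ∤ 6p𝔣 ⇒ IsTwist p 𝔣 𝔩`;
* `finite_setOf_not_isTwist`, ★ `infinite_setOf_isTwist` — all but finitely many primes are admissible twists;
* ★ `exists_isTwist_asIdeal`, `exists_isTwist`, ★ `nonempty_auxIdeals` — the witnesses.
-/

section

set_option linter.dupNamespace false
set_option autoImplicit false

open scoped NumberField
open NumberField IsDedekindDomain
open Literature.NumberTheory.ComplexMultiplication.EllipticUnits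

namespace Summit.BirchSwinnertonDyer.BirchSwinnertonDyer.Theorems.PrintCf2.AuxIdealsWitness

variable {K : Type} [Field K] [NumberField K]

/-- A non-zero prime `𝔩` not dividing `𝔪` is coprime to `𝔪` (`𝔩` is maximal and `𝔪 ⊄ 𝔩`). [folklore] -/
theorem isCoprime_asIdeal_of_not_dvd (v : HeightOneSpectrum (𝓞 K)) {𝔪 : Ideal (𝓞 K)}
    (h : ¬ v.asIdeal ∣ 𝔪) : IsCoprime v.asIdeal 𝔪 := by
  rw [Ideal.isCoprime_iff_sup_eq]
  have hmax : v.asIdeal.IsMaximal := v.isPrime.isMaximal v.ne_bot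
  refine hmax.out.2 _ (lt_of_le_of_ne le_sup_left fun heq ↦ h ?_)
  exact Ideal.dvd_iff_le.mpr (heq ▸ le_sup_right)

/-- Only finitely many primes divide a non-zero ideal (`Ideal.finite_factors`), so the primes NOT coprime
to `𝔪 ≠ 0` form a finite set. [folklore] -/
theorem finite_setOf_not_isCoprime {𝔪 : Ideal (𝓞 K)} (h𝔪 : 𝔪 ≠ ⊥) :
    {v : HeightOneSpectrum (𝓞 K) | ¬ IsCoprime v.asIdeal 𝔪}.Finite :=
  (Ideal.finite_factors h𝔪).subset fun v hv ↦ by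
    by_contra hdvd
    exact hv (isCoprime_asIdeal_of_not_dvd v hdvd)

variable (p : ℕ)

/-- `6p𝔣 ≠ 0` for `𝔣 ≠ 0` (`𝓞 K` has characteristic zero). [cite: Kato2004Asterisque, §15.5 (p. 253)] -/
theorem katoModulus6_ne_bot [Fact p.Prime] {𝔣 : Ideal (𝓞 K)} (h𝔣 : 𝔣 ≠ ⊥) : katoModulus6 p 𝔣 ≠ ⊥ := by
  rw [katoModulus6, Ne, ← Ideal.zero_eq_bot, mul_eq_zero, not_or]
  refine ⟨?_, h𝔣⟩
  rw [Ideal.zero_eq_bot, Ideal.span_singleton_eq_bot]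
  have h6p : (6 * p : ℕ) ≠ 0 := Nat.mul_ne_zero (by norm_num) (Fact.out : p.Prime).ne_zero
  exact_mod_cast h6p

/-- **A prime `𝔩 ∤ 6p𝔣` is an admissible twist** (`IsTwist p 𝔣 𝔩`: prime to `6p𝔣` and `≠ 𝒪_K`).
[cite: Kato2004Asterisque, §15.6 (p. 254)] -/
theorem isTwist_asIdeal_of_not_dvd (𝔣 : Ideal (𝓞 K)) (v : HeightOneSpectrum (𝓞 K))
    (h : ¬ v.asIdeal ∣ katoModulus6 p 𝔣) : IsTwist p 𝔣 v.asIdeal :=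
  ⟨isCoprime_asIdeal_of_not_dvd v h, v.isPrime.ne_top⟩

omit [NumberField K] in
/-- A prime coprime to `6p𝔣` is an admissible twist. [cite: Kato2004Asterisque, §15.6 (p. 254)] -/
theorem isTwist_asIdeal_of_isCoprime (𝔣 : Ideal (𝓞 K)) (v : HeightOneSpectrum (𝓞 K))
    (h : IsCoprime v.asIdeal (katoModulus6 p 𝔣)) : IsTwist p 𝔣 v.asIdeal :=
  ⟨h, v.isPrime.ne_top⟩

/-- The primes that are NOT admissible twists form a finite set (they divide `6p𝔣 ≠ 0`).
[cite: Kato2004Asterisque, §15.6 (p. 254)] -/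
theorem finite_setOf_not_isTwist [Fact p.Prime] {𝔣 : Ideal (𝓞 K)} (h𝔣 : 𝔣 ≠ ⊥) :
    {v : HeightOneSpectrum (𝓞 K) | ¬ IsTwist p 𝔣 v.asIdeal}.Finite :=
  (finite_setOf_not_isCoprime (katoModulus6_ne_bot p h𝔣)).subset fun v hv hc ↦
    hv (isTwist_asIdeal_of_isCoprime p _ v hc)

/-- ★ **Infinitely many primes of `K` are admissible twists for `(p, 𝔣)`, `𝔣 ≠ 0`** (all but the finitely many
dividing `6p𝔣`). [cite: Kato2004Asterisque, §15.6 (p. 254)] -/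
theorem infinite_setOf_isTwist [Fact p.Prime] {𝔣 : Ideal (𝓞 K)} (h𝔣 : 𝔣 ≠ ⊥) :
    {v : HeightOneSpectrum (𝓞 K) | IsTwist p 𝔣 v.asIdeal}.Infinite := by
  haveI := Literature.NumberTheory.Automorphic.infinite_heightOneSpectrum K
  have h := (finite_setOf_not_isTwist p h𝔣).infinite_compl
  simpa only [Set.compl_setOf, not_not] using h

/-- An admissible twist avoiding any given finite set of primes exists. [cite: Kato2004Asterisque, §15.6 (p. 254)] -/
theorem exists_isTwist_asIdeal_not_mem [Fact p.Prime] {𝔣 : Ideal (𝓞 K)} (h𝔣 : 𝔣 ≠ ⊥)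
    {T : Set (HeightOneSpectrum (𝓞 K))} (hT : T.Finite) :
    ∃ v : HeightOneSpectrum (𝓞 K), v ∉ T ∧ IsTwist p 𝔣 v.asIdeal := by
  obtain ⟨v, hv, hvT⟩ := ((infinite_setOf_isTwist p h𝔣).sdiff hT).nonempty
  exact ⟨v, hvT, hv⟩

/-- ★ **An admissible PRIME twist exists**: `∃ 𝔩, IsTwist p 𝔣 𝔩` for `𝔣 ≠ 0`. [cite: Kato2004Asterisque, §15.6 (p. 254)] -/
theorem exists_isTwist_asIdeal [Fact p.Prime] {𝔣 : Ideal (𝓞 K)} (h𝔣 : 𝔣 ≠ ⊥) :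
    ∃ v : HeightOneSpectrum (𝓞 K), IsTwist p 𝔣 v.asIdeal :=
  (infinite_setOf_isTwist p h𝔣).nonempty

/-- **An admissible twist exists**: `∃ 𝔞, IsTwist p 𝔣 𝔞` for `𝔣 ≠ 0`. [cite: Kato2004Asterisque, §15.6 (p. 254)] -/
theorem exists_isTwist [Fact p.Prime] {𝔣 : Ideal (𝓞 K)} (h𝔣 : 𝔣 ≠ ⊥) : ∃ 𝔞 : Ideal (𝓞 K), IsTwist p 𝔣 𝔞 :=
  let ⟨v, hv⟩ := exists_isTwist_asIdeal p h𝔣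
  ⟨v.asIdeal, hv⟩

/-- ★ **`AuxIdeals p 𝔣` is non-empty for `𝔣 ≠ 0`** — the binder `b : AuxIdeals p 𝔣` of the class-frame assemblies
(`TwistedZeta.hZC_of_inputs`, `hLat₀_of_twistedIwasawaData`, …) can always be instantiated.
[cite: Kato2004Asterisque, §15.6 (p. 254)] [cite: JohnsonLeungKings2011, §5.1 (arXiv p0014:L12–20)] -/
theorem nonempty_auxIdeals [Fact p.Prime] {𝔣 : Ideal (𝓞 K)} (h𝔣 : 𝔣 ≠ ⊥) :
    Nonempty (JohnsonLeungKings2011.AuxIdeals p 𝔣) :=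
  let ⟨𝔞, h𝔞⟩ := exists_isTwist p h𝔣
  ⟨⟨𝔞, h𝔞⟩⟩

/-- A prime admissible twist, packaged as an element of `AuxIdeals p 𝔣` whose underlying ideal is a non-zero prime.
[cite: Kato2004Asterisque, §15.6 (p. 254)] -/
theorem exists_auxIdeals_val_eq_asIdeal [Fact p.Prime] {𝔣 : Ideal (𝓞 K)} (h𝔣 : 𝔣 ≠ ⊥) :
    ∃ (b : JohnsonLeungKings2011.AuxIdeals p 𝔣) (v : HeightOneSpectrum (𝓞 K)), (b : Ideal (𝓞 K)) = v.asIdeal :=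
  let ⟨v, hv⟩ := exists_isTwist_asIdeal p h𝔣
  ⟨⟨v.asIdeal, hv⟩, v, rfl⟩

end Summit.BirchSwinnertonDyer.BirchSwinnertonDyer.Theorems.PrintCf2.AuxIdealsWitness

end
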